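import Literature.NumberTheory.Sieve.Maynard2016Lemma93Analytic
import Literature.NumberTheory.Sieve.FGKMT2018Prop91ErrorTerms
import HarnessLib

/-!
# Maynard 2016, Lemma 9.3 in the frame of Proposition 6.1 — leaf M2 (`Maynard2016Lemma93Z`)

Sources: J. Maynard, *Dense clusters of primes in subsets*, Compositio Math. 152 (2016) 1517–1554 =
arXiv:1405.2593 [Maynard2016DenseClusters], Lemma 9.3 p. 22 (display (9.14)) and its proof pp. 23–24
(displays (9.23)–(9.30)), Lemmas 8.2–8.3 pp. 15–17; K. Ford, B. Green, S. Konyagin, J. Maynard, T. Tao,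
*Long gaps between primes*, JAMS 31 (2018) [FordGreenKonyaginMaynardTao2018], Thm 6 p. 21 (the ranges
of `k, B, X, R` of Prop. 6.1 = `FGKMT2018.Prop61Frame`).

This file closes the leaf **M2** of the main part of Prop. 9.2 for `𝒜 = ℤ`
(`Literature.NumberTheory.Sieve.Maynard2016Lemma93Z` of `Maynard2016Prop92MainDecomposition`): it puts
the pointwise estimate `FGKMT2018.abs_yVarM_sub_le` (`Maynard2016Lemma93Analytic`, the end of the chain
Substitution → LocalFactors → AdmBox → EulerProduct → LocalCensus → MainSkeleton → CFree → PPrime →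
EmModulus → Constants → EmSummation → ErrorChain → ErrorBound → MainSum → Analytic) into the ranges of
Prop. 6.1 and converts its three error brackets into Maynard's `O(T_k (log log R)² c_m ∫ F₂ dt_m)`:
* §1 prime-divisor sums of an integer of controlled size: `∑_{p∣N} log p/p ≤ log Λ + 3`,
  `∑_{p∣N} 1/p ≤ log log Λ + 5`, `∏_{p∣N}(1 + 1/p) ≤ e⁵ log Λ` whenever `log N ≤ Λ` (Mertens, upper
  halves, from `MertensElementary`) — the «`(log log R)²`» of the `t ∣ W'/W`-sum and of Lemma 8.3;
* §2 sizes in the frame: `W_m ∣ Δ*_m = ∏_{j≠m}|Δ_{mj}|`, `log Δ*_m ≤ 2k log x`,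
  `log (a_m W B ∏r W_m) ≤ 10 k log x`;
* §3 the growth bookkeeping `eventually_lemma93_aux` (`k ≤ log^{1/5} x`, `X^{1/30} ≤ R ≤ X^{1/9}`);
* §4 the fibre integrals: `∫ F dt_m ≤ ∫ F₂ dt_m`, `∫ F₂ dt_m ≥ 0`;
* §5 `maynard2016Lemma93Z_holds`.

## References
* J. Maynard, *Dense clusters of primes in subsets*, Compositio Math. 152 (2016), Lemma 9.3 p. 22,
  proof pp. 23–24 (9.23)–(9.30), Lemmas 8.2–8.3 pp. 15–17 [Maynard2016DenseClusters].
* K. Ford, B. Green, S. Konyagin, J. Maynard, T. Tao, *Long gaps between primes*, JAMS 31 (2018), Thm 6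
  p. 21 [FordGreenKonyaginMaynardTao2018].
* G. H. Hardy, E. M. Wright, *An introduction to the theory of numbers*, 6th ed. (2008), Thms 425, 427
  (§22.6–22.7) [HardyWright2008] (Mertens' estimates, via `MertensElementary`).
-/

noncomputable section

open Finset Filter
open scoped Nat

namespace Literature.NumberTheory.Sieve

namespace FGKMT2018

variable {k : ℕ}

/-! ## §1 Prime-divisor sums of an integer of controlled size -/

/-- `log 4 ≤ 3/2`, `exp 1 ≤ 3`, `2.7 ≤ exp 1`. [folklore] -/
private theorem lemma93_numeric_consts : Real.log 4 ≤ 3 / 2 ∧ Real.exp 1 ≤ 3 ∧ (2.7 : ℝ) ≤ Real.exp 1 := by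
  refine ⟨?_, ?_, ?_⟩
  · have h : Real.log 4 = 2 * Real.log 2 := by
      rw [show (4 : ℝ) = 2 ^ 2 by norm_num, Real.log_pow]; norm_num
    rw [h]; have := Real.log_two_lt_d9; linarith
  · have := Real.exp_one_lt_d9; linarith
  · have := Real.exp_one_gt_d9; linarith

/-- The primes `p > Λ` dividing `N`, `log N ≤ Λ`: `∑ log p/p ≤ (1/Λ) ∑_{p∣N} log p ≤ log N/Λ ≤ 1`.
[cite: HardyWright2008, §22.6 (proof of Thm 425); folklore splitting at `Λ`] -/
theorem sum_primeFactors_large_log_div_le {N : ℕ} (hN : N ≠ 0) {Λ : ℝ} (hΛ : 0 < Λ)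
    (hNΛ : Real.log N ≤ Λ) :
    ∑ p ∈ N.primeFactors.filter (fun p : ℕ => ¬ (p : ℝ) ≤ Λ), Real.log p / p ≤ 1 := by
  have h1 : ∑ p ∈ N.primeFactors.filter (fun p : ℕ => ¬ (p : ℝ) ≤ Λ), Real.log p / p ≤
      ∑ p ∈ N.primeFactors.filter (fun p : ℕ => ¬ (p : ℝ) ≤ Λ), Real.log p / Λ := by
    refine Finset.sum_le_sum fun p hp => ?_
    rw [Finset.mem_filter, not_le] at hp
    have hpp := Nat.prime_of_mem_primeFactors hp.1
    have hlogp : 0 ≤ Real.log p := Real.log_nonneg (by exact_mod_cast hpp.one_lt.le)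
    exact div_le_div_of_nonneg_left hlogp hΛ hp.2.le
  have h2 : ∑ p ∈ N.primeFactors.filter (fun p : ℕ => ¬ (p : ℝ) ≤ Λ), Real.log p / Λ ≤
      (∑ p ∈ N.primeFactors, Real.log p) / Λ := by
    rw [← Finset.sum_div]
    apply div_le_div_of_nonneg_right _ hΛ.le
    apply Finset.sum_le_sum_of_subset_of_nonneg (Finset.filter_subset _ _)
    intro p hp _
    exact Real.log_nonneg (by exact_mod_cast (Nat.prime_of_mem_primeFactors hp).one_lt.le)
  have h3 : (∑ p ∈ N.primeFactors, Real.log p) / Λ ≤ 1 := by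
    rw [div_le_one hΛ]
    have hrad : ∑ p ∈ N.primeFactors, Real.log p ≤ Real.log N := by
      rw [← Real.log_prod (fun p hp => by
        exact_mod_cast (Nat.prime_of_mem_primeFactors hp).ne_zero)]
      apply Real.log_le_log
      · exact Finset.prod_pos fun p hp => by
          exact_mod_cast (Nat.prime_of_mem_primeFactors hp).pos
      · rw [← Nat.cast_prod]
        exact_mod_cast Nat.le_of_dvd (Nat.pos_of_ne_zero hN) (Nat.prod_primeFactors_dvd N)
    exact hrad.trans hNΛ
  linarith

/-- **`∑_{p∣N} log p/p ≤ log Λ + 3`** when `log N ≤ Λ`, `Λ ≥ 1`: the primes `p ≤ Λ` contribute at most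
`∑_{p≤Λ} log p/p ≤ log Λ + log 4` (Mertens I, upper half), the primes `p > Λ` at most `log N/Λ ≤ 1`.
[cite: HardyWright2008, Thm 425 (§22.6); folklore] -/
theorem sum_primeFactors_log_div_le_of_log_le {N : ℕ} (hN : N ≠ 0) {Λ : ℝ} (hΛ : 1 ≤ Λ)
    (hNΛ : Real.log N ≤ Λ) :
    ∑ p ∈ N.primeFactors, Real.log p / p ≤ Real.log Λ + 3 := by
  have hΛ0 : 0 < Λ := by linarith
  obtain ⟨hlog4, -, -⟩ := lemma93_numeric_consts
  rw [← Finset.sum_filter_add_sum_filter_not N.primeFactors (fun p : ℕ => (p : ℝ) ≤ Λ)]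
  have hsmall : ∑ p ∈ N.primeFactors.filter (fun p : ℕ => (p : ℝ) ≤ Λ), Real.log p / p ≤
      Real.log Λ + Real.log 4 := by
    have hM := Literature.NumberTheory.LFunctions.MertensBound.sum_log_div_prime_le ⌊Λ⌋₊
    have hsub : N.primeFactors.filter (fun p : ℕ => (p : ℝ) ≤ Λ) ⊆ Nat.primesLE ⌊Λ⌋₊ := by
      intro p hp
      rw [Finset.mem_filter] at hp
      exact Nat.mem_primesLE.2 ⟨Nat.le_floor hp.2, Nat.prime_of_mem_primeFactors hp.1⟩
    have h1 : ∑ p ∈ N.primeFactors.filter (fun p : ℕ => (p : ℝ) ≤ Λ), Real.log p / p ≤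
        ∑ p ∈ Nat.primesLE ⌊Λ⌋₊, Real.log p / p :=
      Finset.sum_le_sum_of_subset_of_nonneg hsub fun p hp _ => by
        have hpp := (Nat.mem_primesLE.1 hp).2
        exact div_nonneg (Real.log_nonneg (by exact_mod_cast hpp.one_lt.le)) (Nat.cast_nonneg _)
    have h2 : Real.log (⌊Λ⌋₊ : ℕ) ≤ Real.log Λ := by
      rcases Nat.eq_zero_or_pos ⌊Λ⌋₊ with h0 | hpos
      · rw [h0, Nat.cast_zero, Real.log_zero]; exact Real.log_nonneg hΛ
      · exact Real.log_le_log (by exact_mod_cast hpos) (Nat.floor_le hΛ0.le)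
    linarith
  have hlarge := sum_primeFactors_large_log_div_le hN hΛ0 hNΛ
  linarith

/-- **`∑_{p∣N} 1/p ≤ log log Λ + 5`** when `log N ≤ Λ`, `Λ ≥ 2`: the primes `p ≤ Λ` contribute at most
`log log Λ + 4` (Mertens II, upper half), the primes `p > Λ ≥ 2` satisfy `1/p ≤ log p/p` and contribute at
most `1`. [cite: HardyWright2008, Thm 427 (§22.7); folklore] -/
theorem sum_primeFactors_inv_le_of_log_le {N : ℕ} (hN : N ≠ 0) {Λ : ℝ} (hΛ : 2 ≤ Λ)
    (hNΛ : Real.log N ≤ Λ) :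
    ∑ p ∈ N.primeFactors, 1 / (p : ℝ) ≤ Real.log (Real.log Λ) + 5 := by
  have hΛ0 : 0 < Λ := by linarith
  obtain ⟨-, he3, -⟩ := lemma93_numeric_consts
  rw [← Finset.sum_filter_add_sum_filter_not N.primeFactors (fun p : ℕ => (p : ℝ) ≤ Λ)]
  have hfl2 : 2 ≤ ⌊Λ⌋₊ := Nat.le_floor (by exact_mod_cast hΛ)
  have hsmall : ∑ p ∈ N.primeFactors.filter (fun p : ℕ => (p : ℝ) ≤ Λ), 1 / (p : ℝ) ≤
      Real.log (Real.log Λ) + 4 := by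
    have hM := Literature.NumberTheory.LFunctions.MertensBound.sum_inv_prime_le ⌊Λ⌋₊ hfl2
    have hsub : N.primeFactors.filter (fun p : ℕ => (p : ℝ) ≤ Λ) ⊆ Nat.primesLE ⌊Λ⌋₊ := by
      intro p hp
      rw [Finset.mem_filter] at hp
      exact Nat.mem_primesLE.2 ⟨Nat.le_floor hp.2, Nat.prime_of_mem_primeFactors hp.1⟩
    have h1 : ∑ p ∈ N.primeFactors.filter (fun p : ℕ => (p : ℝ) ≤ Λ), 1 / (p : ℝ) ≤
        ∑ p ∈ Nat.primesLE ⌊Λ⌋₊, 1 / (p : ℝ) :=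
      Finset.sum_le_sum_of_subset_of_nonneg hsub fun p _ _ => by positivity
    have hfl0 : (2 : ℝ) ≤ (⌊Λ⌋₊ : ℕ) := by exact_mod_cast hfl2
    have h2 : Real.log (Real.log (⌊Λ⌋₊ : ℕ)) ≤ Real.log (Real.log Λ) := by
      have hl0 : 0 < Real.log (⌊Λ⌋₊ : ℕ) := Real.log_pos (by linarith)
      exact Real.log_le_log hl0 (Real.log_le_log (by linarith) (Nat.floor_le hΛ0.le))
    linarith
  have hlarge : ∑ p ∈ N.primeFactors.filter (fun p : ℕ => ¬ (p : ℝ) ≤ Λ), 1 / (p : ℝ) ≤ 1 := by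
    refine le_trans (Finset.sum_le_sum fun p hp => ?_) (sum_primeFactors_large_log_div_le hN hΛ0 hNΛ)
    rw [Finset.mem_filter, not_le] at hp
    have hp2 : 2 < p := by
      have : (2 : ℝ) < p := by linarith [hp.2]
      exact_mod_cast this
    have hp3 : Real.exp 1 ≤ p := le_trans he3 (by exact_mod_cast hp2)
    have hp0 : (0 : ℝ) < p := by linarith
    have hlog1 : 1 ≤ Real.log p := by
      rw [← Real.log_exp 1]; exact Real.log_le_log (Real.exp_pos 1) hp3
    exact div_le_div_of_nonneg_right hlog1 hp0.le
  linarith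

/-- `∏ (1 + a_p) ≤ exp(∑ a_p)` for `a_p ≥ 0`. [folklore] -/
private theorem prod_one_add_le_exp_sum' {s : Finset ℕ} {a : ℕ → ℝ} (ha : ∀ p ∈ s, 0 ≤ a p) :
    ∏ p ∈ s, (1 + a p) ≤ Real.exp (∑ p ∈ s, a p) := by
  rw [Real.exp_sum]
  exact Finset.prod_le_prod (fun p hp => by linarith [ha p hp]) fun p _ => by
    linarith [Real.add_one_le_exp (a p)]

/-- **`∏_{p∣N}(1 + 1/p) ≤ e⁵ log Λ`** when `log N ≤ Λ`, `Λ ≥ 2` (`1 + t ≤ e^t` and the previous lemma).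
[cite: HardyWright2008, Thm 427 (§22.7), Thm 429; folklore] -/
theorem prod_primeFactors_one_add_inv_le_of_log_le {N : ℕ} (hN : N ≠ 0) {Λ : ℝ} (hΛ : 2 ≤ Λ)
    (hNΛ : Real.log N ≤ Λ) :
    ∏ p ∈ N.primeFactors, (1 + 1 / (p : ℝ)) ≤ Real.exp 5 * Real.log Λ := by
  have hlogΛ : 0 < Real.log Λ := Real.log_pos (by linarith)
  calc ∏ p ∈ N.primeFactors, (1 + 1 / (p : ℝ))
      ≤ Real.exp (∑ p ∈ N.primeFactors, 1 / (p : ℝ)) :=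
        prod_one_add_le_exp_sum' fun p _ => by positivity
    _ ≤ Real.exp (Real.log (Real.log Λ) + 5) :=
        Real.exp_le_exp.2 (sum_primeFactors_inv_le_of_log_le hN hΛ hNΛ)
    _ = Real.exp 5 * Real.log Λ := by rw [Real.exp_add, Real.exp_log hlogΛ, mul_comm]

/-! ## §2 Sizes in the frame of Proposition 6.1 -/

/-- **`W_m ∣ Δ*_m = ∏_{j ≠ m} |Δ_{mj}|`**: every prime of `W_m` has `p ∤ a_m` and `m ∉ admIdx(p)`, hence divides
some `Δ_{mj}` (`dvd_prod_crossDet_of_not_mem_admIdx`). [cite: Maynard2016DenseClusters, proof of Lemma 9.3 p. 24, (9.27)–(9.28) («W_m ∣ ∏_{j≠m}(a_m b_j − a_j b_m)»)] -/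
theorem mstarProd_dvd_prod_crossDet {L : Fin k → ℤ × ℤ} (hadm : FormsAdmissible L) (B N : ℕ)
    (m : Fin k) (M : ℕ) :
    mstarProd L B N m M ∣ ∏ j ∈ univ.erase m, (crossDet L m j).natAbs := by
  classical
  unfold mstarProd
  refine Finset.prod_primes_dvd _ (fun p hp =>
    (Nat.prime_of_mem_primeFactors (Finset.mem_filter.1 hp).1).prime) fun p hp => ?_
  obtain ⟨hpN, -, -, hpa, hm⟩ := Finset.mem_filter.1 hp
  exact dvd_prod_crossDet_of_not_mem_admIdx hadm m (Nat.prime_of_mem_primeFactors hpN) hpa hm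

/-- **`log Δ*_m ≤ 2k log x`** in the frame: `|Δ_{mj}| = |a_j b_m − a_m b_j| ≤ 2x log³x ≤ x²` for
`|a| ≤ log x`, `|b| ≤ x log²x`, `2 log³ x ≤ x`. [cite: Maynard2016DenseClusters, proof of Prop. 9.2 p. 23 («log A ≪ log x» bookkeeping); FordGreenKonyaginMaynardTao2018, Thm 6 p. 21 (coefficient ranges)] -/
theorem log_prod_crossDet_le {L : Fin k → ℤ × ℤ} (hnd : FormsNondegenerate L) {x : ℝ} (hx : 1 ≤ x)
    (hlx : 2 * Real.log x ^ 3 ≤ x)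
    (hcoef : ∀ i, |(((L i).1 : ℤ) : ℝ)| ≤ Real.log x ∧ |(((L i).2 : ℤ) : ℝ)| ≤ x * Real.log x ^ 2)
    (m : Fin k) :
    Real.log ((∏ j ∈ univ.erase m, (crossDet L m j).natAbs : ℕ) : ℝ) ≤ 2 * k * Real.log x := by
  have hlx0 : 0 ≤ Real.log x := Real.log_nonneg hx
  have hfac : ∀ j, (((crossDet L m j).natAbs : ℕ) : ℝ) ≤ x ^ 2 := by
    intro j
    rw [Nat.cast_natAbs, Int.cast_abs]
    unfold crossDet
    push_cast
    obtain ⟨haj, hbj⟩ := hcoef j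
    obtain ⟨ham, hbm⟩ := hcoef m
    calc |(((L j).1 : ℤ) : ℝ) * (((L m).2 : ℤ) : ℝ) - (((L m).1 : ℤ) : ℝ) * (((L j).2 : ℤ) : ℝ)|
        ≤ |(((L j).1 : ℤ) : ℝ) * (((L m).2 : ℤ) : ℝ)| + |(((L m).1 : ℤ) : ℝ) * (((L j).2 : ℤ) : ℝ)| :=
          abs_sub _ _
      _ = |(((L j).1 : ℤ) : ℝ)| * |(((L m).2 : ℤ) : ℝ)| + |(((L m).1 : ℤ) : ℝ)| * |(((L j).2 : ℤ) : ℝ)| := by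
          rw [abs_mul, abs_mul]
      _ ≤ Real.log x * (x * Real.log x ^ 2) + Real.log x * (x * Real.log x ^ 2) :=
          add_le_add (mul_le_mul haj hbm (abs_nonneg _) hlx0) (mul_le_mul ham hbj (abs_nonneg _) hlx0)
      _ = 2 * Real.log x ^ 3 * x := by ring
      _ ≤ x * x := mul_le_mul_of_nonneg_right hlx (by linarith)
      _ = x ^ 2 := by ring
  have hΔ0 := prod_crossDet_natAbs_ne_zero hnd m
  have hΔpos : (0 : ℝ) < ((∏ j ∈ univ.erase m, (crossDet L m j).natAbs : ℕ) : ℝ) := by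
    exact_mod_cast Nat.pos_of_ne_zero hΔ0
  have hle : ((∏ j ∈ univ.erase m, (crossDet L m j).natAbs : ℕ) : ℝ) ≤ (x ^ 2) ^ (k - 1) := by
    rw [Nat.cast_prod]
    calc ∏ j ∈ univ.erase m, (((crossDet L m j).natAbs : ℕ) : ℝ) ≤ ∏ _j ∈ univ.erase m, x ^ 2 :=
          Finset.prod_le_prod (fun j _ => Nat.cast_nonneg _) fun j _ => hfac j
      _ = (x ^ 2) ^ (k - 1) := by
          rw [Finset.prod_const, Finset.card_erase_of_mem (Finset.mem_univ m), Finset.card_univ,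
            Fintype.card_fin]
  have hk1 : ((k - 1 : ℕ) : ℝ) ≤ k := by exact_mod_cast Nat.sub_le k 1
  calc Real.log ((∏ j ∈ univ.erase m, (crossDet L m j).natAbs : ℕ) : ℝ)
      ≤ Real.log ((x ^ 2) ^ (k - 1)) := Real.log_le_log hΔpos hle
    _ = ((k - 1 : ℕ) : ℝ) * (2 * Real.log x) := by rw [Real.log_pow, Real.log_pow]; push_cast; ring
    _ ≤ k * (2 * Real.log x) := mul_le_mul_of_nonneg_right hk1 (by positivity)
    _ = 2 * k * Real.log x := by ring

/-- **`log (a_m W B ∏r W_m) ≤ 10 k log x`** in the frame (`|a_m| ≤ log x`, `W ≤ 4^{2k²}` with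
`k² ≤ log^{2/5} x ≤ log x`, `B ≤ x`, `∏ rᵢ ≤ R^k` with `log R ≤ 3 log x`, `W_m ≤ Δ*_m ≤ x^{2k}`).
[cite: Maynard2016DenseClusters, proof of Lemma 9.3 p. 24 (the modulus of (9.29)), proof of Prop. 9.2 p. 23; FordGreenKonyaginMaynardTao2018, Thm 6 p. 21] -/
theorem log_emModulus_le {L : Fin k → ℤ × ℤ} (hadm : FormsAdmissible L) (hnd : FormsNondegenerate L)
    {B : ℕ} (hB : B ≠ 0) {x : ℝ} (hx1 : 1 ≤ x) (hlx1 : 1 ≤ Real.log x) (hlx : 2 * Real.log x ^ 3 ≤ x)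
    (hcoef : ∀ i, |(((L i).1 : ℤ) : ℝ)| ≤ Real.log x ∧ |(((L i).2 : ℤ) : ℝ)| ≤ x * Real.log x ^ 2)
    (hBx : (B : ℝ) ≤ x) (hk : (k : ℝ) ≤ Real.log x ^ ((1 : ℝ) / 5)) (hk1 : 1 ≤ k) {R : ℝ} (hR1 : 1 ≤ R)
    (hRx : Real.log R ≤ 3 * Real.log x) {m : Fin k} {r : Fin k → ℕ} (hr : r ∈ dkBoxP L B R m) :
    Real.log ((emModulus L B (primorial ⌊R⌋₊) m (∏ i, r i) : ℕ) : ℝ) ≤ 10 * k * Real.log x := by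
  classical
  have hx0 : 0 < x := by linarith
  have hlx0 : 0 < Real.log x := by linarith
  have hk0 : (1 : ℝ) ≤ k := by exact_mod_cast hk1
  -- the four factors
  set A := (L m).1.natAbs with hA
  set W := wCut k B with hW
  set P := ∏ i, r i with hP
  set Ms := mstarProd L B (primorial ⌊R⌋₊) m P with hMs
  have hA0 : A ≠ 0 := Int.natAbs_ne_zero.2 (hadm.1 m)
  have hW0 : W ≠ 0 := wCut_ne_zero k B
  have hr1 : ∀ i, 1 ≤ r i := one_le_of_mem_dkBox (dkBoxP_subset L B R m hr)
  have hP0 : P ≠ 0 := Finset.prod_ne_zero_iff.2 fun i _ => Nat.one_le_iff_ne_zero.1 (hr1 i)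
  have hΔ0 := prod_crossDet_natAbs_ne_zero hnd m
  have hMsdvd : Ms ∣ ∏ j ∈ univ.erase m, (crossDet L m j).natAbs :=
    mstarProd_dvd_prod_crossDet hadm B _ m P
  have hMs0 : Ms ≠ 0 := fun h => hΔ0 (Nat.eq_zero_of_zero_dvd (h ▸ hMsdvd))
  have hcast : ((emModulus L B (primorial ⌊R⌋₊) m P : ℕ) : ℝ) =
      (A : ℝ) * ((W : ℝ) * B) * P * Ms := by
    unfold emModulus; push_cast; rfl
  -- log A ≤ log x
  have hlogA : Real.log A ≤ Real.log x := by
    have hAle : (A : ℝ) ≤ Real.log x := by rw [hA, Nat.cast_natAbs, Int.cast_abs]; exact (hcoef m).1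
    have hApos : (0 : ℝ) < A := by exact_mod_cast Nat.pos_of_ne_zero hA0
    calc Real.log A ≤ Real.log (Real.log x) := Real.log_le_log hApos hAle
      _ ≤ Real.log x - 1 := Real.log_le_sub_one_of_pos hlx0
      _ ≤ Real.log x := by linarith
  -- log W ≤ 3 log x
  have hlogW : Real.log W ≤ 3 * Real.log x := by
    have hWle : (W : ℝ) ≤ 4 ^ (2 * k ^ 2) := by rw [hW]; exact_mod_cast wCut_le_four_pow k B
    have hWpos : (0 : ℝ) < W := by exact_mod_cast Nat.pos_of_ne_zero hW0
    have hk2 : (k : ℝ) ^ 2 ≤ Real.log x := by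
      have h := pow_le_pow_left₀ (Nat.cast_nonneg k) hk 2
      rw [← Real.rpow_natCast (Real.log x ^ ((1 : ℝ) / 5)) 2, ← Real.rpow_mul hlx0.le] at h
      norm_num at h
      exact h.trans (Real.rpow_le_self_of_one_le hlx1 (by norm_num))
    obtain ⟨hlog4, -, -⟩ := lemma93_numeric_consts
    calc Real.log W ≤ Real.log ((4 : ℝ) ^ (2 * k ^ 2)) := Real.log_le_log hWpos hWle
      _ = (2 * k ^ 2 : ℕ) * Real.log 4 := by rw [Real.log_pow]
      _ ≤ (2 * Real.log x) * (3 / 2) := by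
          push_cast
          exact mul_le_mul (by linarith) hlog4 (Real.log_nonneg (by norm_num)) (by positivity)
      _ = 3 * Real.log x := by ring
  -- log B ≤ log x
  have hlogB : Real.log B ≤ Real.log x :=
    Real.log_le_log (by exact_mod_cast Nat.pos_of_ne_zero hB) hBx
  -- log P ≤ 3 k log x
  have hlogP : Real.log P ≤ 3 * k * Real.log x := by
    have hri : ∀ i, (r i : ℝ) ≤ R := fun i => by
      have h := (Finset.mem_Icc.1 ((mem_dkBox_iff.1 (dkBoxP_subset L B R m hr)).1 i)).2
      exact le_trans (by exact_mod_cast h) (Nat.floor_le (by linarith))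
    have hPle : (P : ℝ) ≤ R ^ k := by
      rw [hP, Nat.cast_prod]
      calc ∏ i, (r i : ℝ) ≤ ∏ _i : Fin k, R :=
            Finset.prod_le_prod (fun i _ => Nat.cast_nonneg _) fun i _ => hri i
        _ = R ^ k := by rw [Finset.prod_const, Finset.card_univ, Fintype.card_fin]
    have hPpos : (0 : ℝ) < P := by exact_mod_cast Nat.pos_of_ne_zero hP0
    calc Real.log P ≤ Real.log (R ^ k) := Real.log_le_log hPpos hPle
      _ = k * Real.log R := by rw [Real.log_pow]
      _ ≤ k * (3 * Real.log x) := mul_le_mul_of_nonneg_left hRx (Nat.cast_nonneg k)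
      _ = 3 * k * Real.log x := by ring
  -- log W_m ≤ 2 k log x
  have hlogMs : Real.log Ms ≤ 2 * k * Real.log x := by
    have hMsle : (Ms : ℝ) ≤ ((∏ j ∈ univ.erase m, (crossDet L m j).natAbs : ℕ) : ℝ) := by
      exact_mod_cast Nat.le_of_dvd (Nat.pos_of_ne_zero hΔ0) hMsdvd
    have hMspos : (0 : ℝ) < Ms := by exact_mod_cast Nat.pos_of_ne_zero hMs0
    exact (Real.log_le_log hMspos hMsle).trans (log_prod_crossDet_le hnd hx1 hlx hcoef m)
  have hApos : (0 : ℝ) < A := by exact_mod_cast Nat.pos_of_ne_zero hA0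
  have hWpos : (0 : ℝ) < W := by exact_mod_cast Nat.pos_of_ne_zero hW0
  have hBpos : (0 : ℝ) < B := by exact_mod_cast Nat.pos_of_ne_zero hB
  have hPpos : (0 : ℝ) < P := by exact_mod_cast Nat.pos_of_ne_zero hP0
  have hMspos : (0 : ℝ) < Ms := by exact_mod_cast Nat.pos_of_ne_zero hMs0
  rw [hcast, Real.log_mul (by positivity) hMspos.ne', Real.log_mul (by positivity) hPpos.ne',
    Real.log_mul hApos.ne' (by positivity), Real.log_mul hWpos.ne' hBpos.ne']
  have hk5 : 5 * Real.log x ≤ 5 * k * Real.log x := by nlinarith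
  linarith

/-! ## §3 Growth bookkeeping in the ranges of Proposition 6.1 -/

/-- In the ranges of Prop. 6.1 (`k ≤ (log x)^{1/5}`, `x/2 ≤ X ≤ x log²x`, `X^{1/30} ≤ R ≤ X^{1/9}`),
eventually in `x`: `X ≥ 1`, `log x ≥ 1`, `2 log³x ≤ x`, `log R ≤ 3 log x`, `log R ≥ 1`, `log log R ≥ 10`,
`log log x ≤ 4 + log log R`, `k ≤ 31 log R`, `2000 log² R ≤ R − 1`, `k³ log log R ≤ 80 log R`.
[cite: Maynard2016DenseClusters, proof of Lemma 9.3 p. 24 and of Prop. 9.2 p. 23 («k ≤ (log x)^{1/5} and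
R ≥ X^{1/30}»); FordGreenKonyaginMaynardTao2018, Thm 6 p. 21 (ranges)] -/
theorem eventually_lemma93_aux :
    ∀ᶠ x : ℕ in atTop, ∀ k : ℕ, (k : ℝ) ≤ Real.log x ^ ((1 : ℝ) / 5) → ∀ X R : ℝ,
      (x : ℝ) / 2 ≤ X → X ≤ x * Real.log x ^ 2 → X ^ ((1 : ℝ) / 30) ≤ R → R ≤ X ^ ((1 : ℝ) / 9) →
        1 ≤ X ∧ 1 ≤ Real.log x ∧ 2 * Real.log x ^ 3 ≤ x ∧ Real.log R ≤ 3 * Real.log x ∧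
          1 ≤ Real.log R ∧ 10 ≤ Real.log (Real.log R) ∧
          Real.log (Real.log x) ≤ 4 + Real.log (Real.log R) ∧ (k : ℝ) ≤ 31 * Real.log R ∧
          2000 * Real.log R ^ 2 ≤ R - 1 ∧ (k : ℝ) ^ 3 * Real.log (Real.log R) ≤ 80 * Real.log R := by
  obtain ⟨hlog4, he3, he27⟩ := lemma93_numeric_consts
  have hlog2 : Real.log 2 ≤ 1 := by have := Real.log_two_lt_d9; linarith
  have hexp2 : Real.exp 2 ≤ 9 := by
    have : Real.exp 2 = Real.exp 1 * Real.exp 1 := by rw [← Real.exp_add]; norm_num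
    rw [this]; nlinarith [Real.exp_pos (1 : ℝ)]
  have hexp4 : (31 : ℝ) ≤ Real.exp 4 := by
    have h : Real.exp 4 = Real.exp 1 ^ 4 := by rw [← Real.exp_nat_mul]; norm_num
    rw [h]
    have := pow_le_pow_left₀ (by norm_num) he27 4
    linarith [show (31 : ℝ) ≤ (2.7 : ℝ) ^ 4 by norm_num]
  have hexp12 : (150000 : ℝ) ≤ Real.exp 12 := by
    have h : Real.exp 12 = Real.exp 1 ^ 12 := by rw [← Real.exp_nat_mul]; norm_num
    rw [h]
    have := pow_le_pow_left₀ (by norm_num) he27 12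
    linarith [show (150000 : ℝ) ≤ (2.7 : ℝ) ^ 12 by norm_num]
  have hL : Tendsto (fun x : ℕ => Real.log (x : ℝ)) atTop atTop :=
    Real.tendsto_log_atTop.comp tendsto_natCast_atTop_atTop
  have hlo : ∀ᶠ x : ℕ in atTop, ‖Real.log (x : ℝ) ^ 3‖ ≤ 1 / 2 * ‖(id (x : ℝ))‖ :=
    tendsto_natCast_atTop_atTop.eventually
      ((Real.isLittleO_pow_log_id_atTop (n := 3)).def (by norm_num : (0 : ℝ) < 1 / 2))
  filter_upwards [eventually_ge_atTop 16, hL.eventually_ge_atTop (2 + 30 * Real.exp 12), hlo]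
    with x hx16 hlogx hlo3 k hk X R hX1 hX2 hR1 hR2
  have hx16' : (16 : ℝ) ≤ x := by exact_mod_cast hx16
  have hx0 : (0 : ℝ) < x := by linarith
  set lx := Real.log (x : ℝ) with hlx
  have hlx2 : 2 ≤ lx := by rw [hlx, Real.le_log_iff_exp_le hx0]; linarith
  have hlx1 : 1 ≤ lx := by linarith
  have hlx0 : 0 < lx := by linarith
  have hX1' : 1 ≤ X := by linarith
  have hX0 : 0 < X := by linarith
  have hlogX : lx - Real.log 2 ≤ Real.log X := by
    rw [hlx, ← Real.log_div hx0.ne' two_ne_zero]; exact Real.log_le_log (by positivity) hX1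
  have hlogX0 : 0 ≤ Real.log X := Real.log_nonneg hX1'
  -- `log R ≥ log X/30`, `log R ≤ log X/9`
  have hXr : 0 < X ^ ((1 : ℝ) / 30) := Real.rpow_pos_of_pos hX0 _
  have hR0 : 0 < R := lt_of_lt_of_le hXr hR1
  have hlogR1 : Real.log X / 30 ≤ Real.log R := by
    have h := Real.log_le_log hXr hR1
    rw [Real.log_rpow hX0] at h; linarith
  have hlogR2 : Real.log R ≤ Real.log X / 9 := by
    have h := Real.log_le_log hR0 hR2
    rw [Real.log_rpow hX0] at h; linarith
  -- `log X ≤ log x + 2 log log x ≤ 3 log x`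
  have hlogX3 : Real.log X ≤ 3 * lx := by
    have h1 : Real.log X ≤ Real.log ((x : ℝ) * lx ^ 2) := Real.log_le_log hX0 hX2
    rw [Real.log_mul hx0.ne' (by positivity), Real.log_pow] at h1
    have h2 : Real.log lx ≤ lx - 1 := Real.log_le_sub_one_of_pos hlx0
    push_cast at h1; rw [← hlx] at h1; linarith
  have hlR12 : Real.exp 12 ≤ Real.log R := by linarith
  have hlR1 : 1 ≤ Real.log R := by linarith
  have hlR0 : 0 < Real.log R := by linarith
  have hll : 12 ≤ Real.log (Real.log R) := by
    rw [Real.le_log_iff_exp_le hlR0]; exact hlR12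
  -- `log x ≤ 31 log R`, `log log x ≤ log 31 + log log R ≤ 4 + log log R`
  have hx31 : lx ≤ 31 * Real.log R := by linarith
  have hllx : Real.log lx ≤ 4 + Real.log (Real.log R) := by
    calc Real.log lx ≤ Real.log (31 * Real.log R) := Real.log_le_log hlx0 hx31
      _ = Real.log 31 + Real.log (Real.log R) := Real.log_mul (by norm_num) hlR0.ne'
      _ ≤ 4 + Real.log (Real.log R) := by
          have : Real.log 31 ≤ 4 := by
            rw [Real.log_le_iff_le_exp (by norm_num)]; exact hexp4
          linarith
  -- `k ≤ lx ≤ 31 log R`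
  have hk0 : (0 : ℝ) ≤ k := Nat.cast_nonneg k
  have hklx : (k : ℝ) ≤ lx := hk.trans (Real.rpow_le_self_of_one_le hlx1 (by norm_num))
  -- `2000 log² R ≤ R − 1`
  have hRbig : 2000 * Real.log R ^ 2 ≤ R - 1 := by
    set s := R ^ ((1 : ℝ) / 2) with hs
    have hs0 : 0 ≤ s := Real.rpow_nonneg hR0.le _
    have hR : R = s ^ 2 := by
      rw [hs, ← Real.rpow_natCast (R ^ ((1 : ℝ) / 2)) 2, ← Real.rpow_mul hR0.le]; norm_num
    have hq : R ^ ((1 : ℝ) / 4) ≥ 0 := Real.rpow_nonneg hR0.le _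
    have hq2 : (R ^ ((1 : ℝ) / 4)) ^ 2 = s := by
      rw [hs, ← Real.rpow_natCast (R ^ ((1 : ℝ) / 4)) 2, ← Real.rpow_mul hR0.le]; norm_num
    have hlog : Real.log R ≤ 4 * R ^ ((1 : ℝ) / 4) := by
      have := Real.log_le_rpow_div hR0.le (by norm_num : (0 : ℝ) < 1 / 4)
      linarith
    have hlog2' : Real.log R ^ 2 ≤ 16 * s := by
      have h := pow_le_pow_left₀ hlR0.le hlog 2
      rw [mul_pow, hq2] at h; linarith
    -- `s = exp(log R/2) ≥ 1 + log R/2 ≥ 75001`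
    have hsbig : 75001 ≤ s := by
      have h1 : s = Real.exp (Real.log R * ((1 : ℝ) / 2)) := by
        rw [hs, Real.rpow_def_of_pos hR0]
      have h2 := Real.add_one_le_exp (Real.log R * ((1 : ℝ) / 2))
      rw [← h1] at h2; linarith
    have hprod : 0 ≤ (s - 75001) * s := mul_nonneg (by linarith) hs0
    have hR' : R - 1 = s ^ 2 - 1 := by rw [hR]
    rw [hR']; nlinarith
  -- `k³ log log R ≤ 80 log R`
  have hk3 : (k : ℝ) ^ 3 * Real.log (Real.log R) ≤ 80 * Real.log R := by
    have h3 : (k : ℝ) ^ 3 ≤ lx ^ ((3 : ℝ) / 5) := by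
      have h := pow_le_pow_left₀ hk0 hk 3
      rw [← Real.rpow_natCast (lx ^ ((1 : ℝ) / 5)) 3, ← Real.rpow_mul hlx0.le] at h
      norm_num at h; exact h
    have h4 : lx ^ ((3 : ℝ) / 5) ≤ 31 * Real.log R ^ ((3 : ℝ) / 5) := by
      calc lx ^ ((3 : ℝ) / 5) ≤ (31 * Real.log R) ^ ((3 : ℝ) / 5) :=
            Real.rpow_le_rpow hlx0.le hx31 (by norm_num)
        _ = (31 : ℝ) ^ ((3 : ℝ) / 5) * Real.log R ^ ((3 : ℝ) / 5) :=
            Real.mul_rpow (by norm_num) hlR0.le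
        _ ≤ 31 * Real.log R ^ ((3 : ℝ) / 5) :=
            mul_le_mul_of_nonneg_right (Real.rpow_le_self_of_one_le (by norm_num) (by norm_num))
              (Real.rpow_nonneg hlR0.le _)
    have h5 : Real.log (Real.log R) ≤ Real.log R ^ ((2 : ℝ) / 5) / ((2 : ℝ) / 5) :=
      Real.log_le_rpow_div hlR0.le (by norm_num)
    have h6 : Real.log R ^ ((3 : ℝ) / 5) * Real.log R ^ ((2 : ℝ) / 5) = Real.log R := by
      rw [← Real.rpow_add hlR0]; norm_num
    have hll0 : 0 ≤ Real.log (Real.log R) := by linarith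
    calc (k : ℝ) ^ 3 * Real.log (Real.log R)
        ≤ (31 * Real.log R ^ ((3 : ℝ) / 5)) * (Real.log R ^ ((2 : ℝ) / 5) / ((2 : ℝ) / 5)) :=
          mul_le_mul (h3.trans h4) h5 hll0 (by positivity)
      _ = (155 / 2) * (Real.log R ^ ((3 : ℝ) / 5) * Real.log R ^ ((2 : ℝ) / 5)) := by ring
      _ = (155 / 2) * Real.log R := by rw [h6]
      _ ≤ 80 * Real.log R := by linarith
  -- `2 log³ x ≤ x`
  have hlo' : 2 * lx ^ 3 ≤ x := by
    have h := hlo3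
    rw [Real.norm_eq_abs, Real.norm_eq_abs, abs_of_nonneg (by positivity), id,
      abs_of_nonneg hx0.le] at h
    rw [hlx]; linarith
  exact ⟨hX1', hlx1, hlo', by linarith, hlR1, by linarith, hllx, by linarith, hRbig, hk3⟩

/-! ## §4 The fibre integrals -/

/-- `∫₀^∞ F(u; u_m := t) dt ≤ ∫₀^∞ F₂(u; u_m := t) dt` on the orthant (`0 ≤ F ≤ F₁ ≤ k F₁ ≤ F₂`).
[cite: Maynard2016DenseClusters, proof of Lemma 8.6 p. 18 («trivially F ≤ F₁», «k F₁ ≤ F₂»), Lemma 9.3 p. 22] -/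
theorem margInt_F_le_margInt_F₂ (hk : 2 ≤ k) {u : Fin k → ℝ} (hu : u ∈ MaynardDense.orthant k)
    (m : Fin k) :
    margInt m (MaynardDense.F k) u ≤ margInt m (MaynardDense.F₂ k) u := by
  unfold margInt
  have hk1 : (1 : ℝ) ≤ k := by exact_mod_cast (le_trans (by norm_num) hk : 1 ≤ k)
  refine MeasureTheory.integral_mono_of_nonneg ?_ (MaynardDense.integrableOn_F₂_update hk u m) ?_
  · exact (MeasureTheory.ae_restrict_iff' measurableSet_Ici).2 (Eventually.of_forall fun t ht =>
      MaynardDense.F_nonneg hk (MaynardDense.update_mem_orthant hu m (Set.mem_Ici.1 ht)))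
  · refine (MeasureTheory.ae_restrict_iff' measurableSet_Ici).2 (Eventually.of_forall fun t ht => ?_)
    have hut := MaynardDense.update_mem_orthant hu m (Set.mem_Ici.1 ht)
    have h1 := MaynardDense.F_le_F₁ hk hut
    have h2 := MaynardDense.mul_F₁_le_F₂ hk hut
    have h3 := MaynardDense.F₁_nonneg hk hut
    nlinarith

/-- `∫₀^∞ F₂(u; u_m := t) dt ≥ 0` on the orthant. [cite: Maynard2016DenseClusters, Lemma 9.3 p. 22] -/
theorem margInt_F₂_nonneg (hk : 2 ≤ k) {u : Fin k → ℝ} (hu : u ∈ MaynardDense.orthant k) (m : Fin k) :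
    0 ≤ margInt m (MaynardDense.F₂ k) u :=
  MeasureTheory.setIntegral_nonneg measurableSet_Ici fun _ ht =>
    MaynardDense.F₂_nonneg hk (MaynardDense.update_mem_orthant hu m (Set.mem_Ici.1 ht))

/-- `∫₀^∞ F(u; u_m := t) dt ≥ 0` on the orthant. [cite: Maynard2016DenseClusters, Lemma 9.3 p. 22] -/
theorem margInt_F_nonneg (hk : 2 ≤ k) {u : Fin k → ℝ} (hu : u ∈ MaynardDense.orthant k) (m : Fin k) :
    0 ≤ margInt m (MaynardDense.F k) u :=
  MeasureTheory.setIntegral_nonneg measurableSet_Ici fun _ ht =>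
    MaynardDense.F_nonneg hk (MaynardDense.update_mem_orthant hu m (Set.mem_Ici.1 ht))

/-! ## §5 Lemma 9.3 in the frame -/

/-- The arithmetic of the three error brackets of `abs_yVarM_sub_le` (all quantities as real atoms):
`E₁ ≤ ∫F₂`, `E₂ ≤ 1860 C₁ T ℓ² ∫F₂`, `E₃ ≤ 6e K'_Δ (1 + 2400 C₂) T ℓ² ∫F₂` (bookkeeping for (9.30)).
[folklore] [cite: Maynard2016DenseClusters, proof of Lemma 9.3 p. 24 (9.30)] -/
private theorem lemma93_arith {k N logR logk I I₂ C₁ C₂ Q A Pg S S' KΔ KΔ' F0 T ℓ cM e : ℝ}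
    (hN : 4 * k * logR ≤ N) (hN0 : 0 < N) (hlogR : 0 < logR)
    (hI0 : 0 ≤ I) (hI : I ≤ I₂) (hI₂ : 0 ≤ I₂) (hC₁ : 0 ≤ C₁) (hC₂ : 0 ≤ C₂)
    (hQ0 : 0 ≤ Q) (hQ : Q ≤ 5 * ℓ) (hA0 : 0 ≤ A) (hA : A ≤ 93 * T)
    (hPg0 : 0 ≤ Pg) (hPg : T * Pg ≤ 2 * T * I₂) (hS : S ≤ 3 * T) (hS'0 : 0 ≤ S')
    (hS' : S' ≤ 3 * T) (hKΔ0 : 0 ≤ KΔ) (hKΔ : KΔ ≤ KΔ' * ℓ ^ 2) (hKΔ'0 : 0 ≤ KΔ') (hF0 : 0 ≤ F0)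
    (hF0b : F0 ≤ 2 * T / logk * I₂) (hlogk : 0 < logk) (hT1 : 1 ≤ T) (hℓ : 1 ≤ ℓ)
    (hk3 : T ^ 2 * ℓ ≤ 80 * logk * logR) (hcM : 0 ≤ cM) (he : 0 ≤ e) :
    cM * (4 * k / N * logR * I + 2 * C₁ * Q * (A * Pg) +
        2 * e * S * KΔ * (I₂ + C₂ * Q * (S' * F0) / logR)) ≤
      (1 + 1860 * C₁ + 6 * e * KΔ' * (1 + 2400 * C₂)) * T * ℓ ^ 2 * cM * I₂ := by
  have hT0 : 0 < T := by linarith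
  have hℓ0 : 0 < ℓ := by linarith
  have hℓsq : ℓ ≤ ℓ ^ 2 := by nlinarith
  have hTℓ : 1 ≤ T * ℓ ^ 2 := by nlinarith
  have hV0 : 0 ≤ T * ℓ ^ 2 * I₂ := by positivity
  -- E₁
  have hE1 : 4 * k / N * logR * I ≤ T * ℓ ^ 2 * I₂ := by
    have h1 : 4 * k / N * logR ≤ 1 := by
      rw [div_mul_eq_mul_div, div_le_one hN0]; linarith
    have h2 : 4 * k / N * logR * I ≤ 1 * I₂ := mul_le_mul h1 hI hI0 zero_le_one
    have h3 : I₂ ≤ T * ℓ ^ 2 * I₂ := le_mul_of_one_le_left hI₂ hTℓ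
    linarith
  -- E₂
  have hE2 : 2 * C₁ * Q * (A * Pg) ≤ 1860 * C₁ * (T * ℓ ^ 2 * I₂) := by
    have h1 : A * Pg ≤ 93 * T * Pg := mul_le_mul_of_nonneg_right hA hPg0
    have h2 : A * Pg ≤ 186 * T * I₂ := by nlinarith
    have h3 : 2 * C₁ * Q ≤ 2 * C₁ * (5 * ℓ) := mul_le_mul_of_nonneg_left hQ (by positivity)
    calc 2 * C₁ * Q * (A * Pg) ≤ 2 * C₁ * (5 * ℓ) * (186 * T * I₂) :=
          mul_le_mul h3 h2 (by positivity) (by positivity)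
      _ = 1860 * C₁ * (T * ℓ * I₂) := by ring
      _ ≤ 1860 * C₁ * (T * ℓ ^ 2 * I₂) := by
          apply mul_le_mul_of_nonneg_left _ (by positivity)
          exact mul_le_mul_of_nonneg_right (mul_le_mul_of_nonneg_left hℓsq hT0.le) hI₂
  -- E₃, inner term
  have hG : C₂ * Q * (S' * F0) / logR ≤ 2400 * C₂ * I₂ := by
    rw [div_le_iff₀ hlogR]
    have h1 : Q * (S' * F0) ≤ (5 * ℓ) * (3 * T * (2 * T / logk * I₂)) :=
      mul_le_mul hQ (mul_le_mul hS' hF0b hF0 (by positivity)) (by positivity) (by positivity)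
    have h2 : (5 * ℓ) * (3 * T * (2 * T / logk * I₂)) = 30 * (T ^ 2 * ℓ) / logk * I₂ := by
      field_simp
      ring
    have h3 : 30 * (T ^ 2 * ℓ) / logk * I₂ ≤ 30 * (80 * logR) * I₂ := by
      apply mul_le_mul_of_nonneg_right _ hI₂
      rw [div_le_iff₀ hlogk]
      nlinarith
    have h4 : Q * (S' * F0) ≤ 30 * (80 * logR) * I₂ := by rw [h2] at h1; exact h1.trans h3
    calc C₂ * Q * (S' * F0) = C₂ * (Q * (S' * F0)) := by ring
      _ ≤ C₂ * (30 * (80 * logR) * I₂) := mul_le_mul_of_nonneg_left h4 hC₂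
      _ = 2400 * C₂ * I₂ * logR := by ring
  have hE3 : 2 * e * S * KΔ * (I₂ + C₂ * Q * (S' * F0) / logR) ≤
      6 * e * KΔ' * (1 + 2400 * C₂) * (T * ℓ ^ 2 * I₂) := by
    have h1 : I₂ + C₂ * Q * (S' * F0) / logR ≤ (1 + 2400 * C₂) * I₂ := by linarith
    have h0 : 0 ≤ I₂ + C₂ * Q * (S' * F0) / logR := by positivity
    have h2 : 2 * e * S * KΔ ≤ 2 * e * (3 * T) * (KΔ' * ℓ ^ 2) :=
      mul_le_mul (mul_le_mul_of_nonneg_left hS (by positivity)) hKΔ hKΔ0 (by positivity)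
    calc 2 * e * S * KΔ * (I₂ + C₂ * Q * (S' * F0) / logR)
        ≤ (2 * e * (3 * T) * (KΔ' * ℓ ^ 2)) * ((1 + 2400 * C₂) * I₂) :=
          mul_le_mul h2 h1 h0 (by positivity)
      _ = 6 * e * KΔ' * (1 + 2400 * C₂) * (T * ℓ ^ 2 * I₂) := by ring
  have hsum := add_le_add (add_le_add hE1 hE2) hE3
  calc cM * (4 * k / N * logR * I + 2 * C₁ * Q * (A * Pg) +
        2 * e * S * KΔ * (I₂ + C₂ * Q * (S' * F0) / logR))
      ≤ cM * (T * ℓ ^ 2 * I₂ + 1860 * C₁ * (T * ℓ ^ 2 * I₂) +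
          6 * e * KΔ' * (1 + 2400 * C₂) * (T * ℓ ^ 2 * I₂)) := mul_le_mul_of_nonneg_left hsum hcM
    _ = (1 + 1860 * C₁ + 6 * e * KΔ' * (1 + 2400 * C₂)) * T * ℓ ^ 2 * cM * I₂ := by ring

/-- **Lemma 9.3 [Maynard2016DenseClusters, p. 22 (9.14)] for `𝒜 = ℤ`, in the frame of Prop. 6.1 — the
leaf M2 of Prop. 9.2**: for `k ≥ 2¹⁸` and the ranges of Prop. 6.1, for every `m`, every `B` and every
`r ∈ 𝒟'^{(m)}_k`, `|y^{(m)}_r − (log R) c_m ∫ F dt_m| ≤ K T_k (log log R)² c_m ∫ F₂ dt_m`.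
Proof: `abs_yVarM_sub_le` (the printed proof: substitution (8.6), the local factors (9.24), the
`(s,t)`-Euler product (9.27), Lemma 8.2 for `y_e − y_{r'}`, the `e_m`-summation (9.29) by Lemma 8.3) and
the bookkeeping of this file: `4k log R ≤ ⌊R⌋ + 1`, `∫F ≤ ∫F₂` (E₁); `31(1 + 30/U + T) ≤ 93T`,
`T ∏g ≤ 2T ∫F₂`, `9 + ∑_{p ∣ a_mWB∏rW_m} log p/p ≤ 5 log log R` (E₂); `30 + 30/U + T ≤ 3T`,
`∏_{p∣Δ*}(1+1/p)(1 + ∑_{p∣Δ*} log p/p) ≤ 16 e⁵ (log log R)²`, `F₂(u;0) ≤ (2T/log k) ∫F₂`,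
`T_k² log log R ≤ 80 log k log R` (E₃). [cite: Maynard2016DenseClusters, Lemma 9.3 p. 22 (9.14), proof pp. 23–24 (9.23)–(9.30), Lemmas 8.2–8.3 pp. 15–17; FordGreenKonyaginMaynardTao2018, Thm 6 p. 21] -/
theorem maynard2016Lemma93Z_holds : Maynard2016Lemma93Z := by
  classical
  obtain ⟨C₁, C₂, hC₁0, hC₂0, hpt⟩ := abs_yVarM_sub_le
  obtain ⟨-, he3, -⟩ := lemma93_numeric_consts
  set KΔ' : ℝ := 2 * Real.exp 6 * Real.exp (2 * Real.exp 6) * (Real.exp 5 * 4) * 4 with hKΔ'def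
  have hKΔ'0 : 0 ≤ KΔ' := by rw [hKΔ'def]; positivity
  refine ⟨262144, 1 + 1860 * C₁ + 6 * Real.exp 1 * KΔ' * (1 + 2400 * C₂), by positivity, ?_⟩
  unfold Prop61Frame
  filter_upwards [eventually_lemma93_aux] with x hx B hB hBx k L X R hCk hk hadm hnd hcoef hX1 hX2
    hR1 hR2
  intro m _ r hr
  obtain ⟨hXone, hlx1, hlx3, hlogR3, hlR1, hll10, hllx, hk31, hRbig, hk3⟩ :=
    hx k hk X R hX1 hX2 hR1 hR2
  -- basic facts
  have hk2 : 2 ≤ k := le_trans (by norm_num) hCk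
  have hk1 : 1 ≤ k := le_trans (by norm_num) hCk
  have hk3' : 3 ≤ k := le_trans (by norm_num) hCk
  have hkr1 : (1 : ℝ) ≤ k := by exact_mod_cast hk1
  have hk0 : (0 : ℝ) ≤ k := Nat.cast_nonneg k
  have hkpos : (0 : ℝ) < k := by linarith
  have hB0 : B ≠ 0 := hB.elim (fun h => by rw [h]; exact one_ne_zero) fun h => h.ne_zero
  have hlR0 : 0 < Real.log R := by linarith
  have hR0 : 0 < R := lt_of_lt_of_le (Real.rpow_pos_of_pos (by linarith) _) hR1
  have hR2' : 2 ≤ R := by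
    by_contra h
    rw [not_le] at h
    have h1 := Real.log_lt_log hR0 h
    have h2 : Real.log 2 ≤ 1 := by have := Real.log_two_lt_d9; linarith
    linarith
  have hR1le : 1 ≤ R := by linarith
  have hlx0 : 0 < Real.log x := by linarith
  have hx1 : (1 : ℝ) ≤ x := by
    have : (1 : ℝ) ≤ Real.log x ^ 3 := one_le_pow₀ hlx1
    linarith
  have hBx' : (B : ℝ) ≤ x := by exact_mod_cast hBx
  -- integer parts (no `hmain` in context yet: keep the arithmetic tactics light)
  have hfl : R - 1 < ⌊R⌋₊ := by have := Nat.lt_floor_add_one R; linarith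
  have hkk : (k : ℝ) ^ 2 ≤ 961 * Real.log R ^ 2 := by
    have h := pow_le_pow_left₀ hk0 hk31 2
    rw [mul_pow] at h; norm_num at h; exact h
  have hklR : (k : ℝ) * Real.log R ≤ 31 * Real.log R ^ 2 := by
    have h := mul_le_mul_of_nonneg_right hk31 hlR0.le
    rw [mul_assoc, ← pow_two] at h; exact h
  have hlRsq : Real.log R ≤ Real.log R ^ 2 := by
    rw [pow_two]; exact le_mul_of_one_le_left hlR0.le hlR1
  have hRk : 2 * k ^ 2 ≤ ⌊R⌋₊ := by
    have h : ((2 * k ^ 2 : ℕ) : ℝ) ≤ (⌊R⌋₊ : ℝ) := by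
      push_cast; linarith only [hkk, hRbig, hfl]
    exact_mod_cast h
  have hRk4 : 4 * k ≤ ⌊R⌋₊ + 1 := by
    have h : ((4 * k : ℕ) : ℝ) ≤ ((⌊R⌋₊ + 1 : ℕ) : ℝ) := by
      push_cast; linarith only [hk31, hlRsq, hRbig, hfl]
    exact_mod_cast h
  have hN : 4 * (k : ℝ) * Real.log R ≤ ((⌊R⌋₊ + 1 : ℕ) : ℝ) := by
    push_cast; linarith only [hklR, hRbig, hfl]
  have hN0 : (0 : ℝ) < ((⌊R⌋₊ + 1 : ℕ) : ℝ) := by positivity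
  -- abbreviations
  set T := MaynardDense.T k with hTdef
  set U := MaynardDense.U k with hUdef
  set ℓ := Real.log (Real.log R) with hℓdef
  set u := logVec R r with hudef
  set I := margInt m (MaynardDense.F k) u with hIdef
  set I₂ := margInt m (MaynardDense.F₂ k) u with hI₂def
  set M := emModulus L B (primorial ⌊R⌋₊) m (∏ i, r i) with hMdef
  set SM := ∑ p ∈ M.primeFactors, Real.log p / p with hSMdef
  set Δ := ∏ j ∈ univ.erase m, (crossDet L m j).natAbs with hΔdef
  set P₁ := ∏ p ∈ Δ.primeFactors, (1 + 1 / (p : ℝ)) with hP₁def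
  set S₁ := ∑ p ∈ Δ.primeFactors, Real.log p / p with hS₁def
  set Pg := ∏ i ∈ univ.erase m, MaynardDense.prof k (u i) with hPgdef
  set F0 := MaynardDense.F₂ k (Function.update u m 0) with hF0def
  -- the orthant and the fibre integrals
  have hr1 : ∀ i, 1 ≤ r i := one_le_of_mem_dkBox (dkBoxP_subset L B R m hr)
  have hprod0 : (∏ i, r i) ≠ 0 :=
    Finset.prod_ne_zero_iff.2 fun i _ => Nat.one_le_iff_ne_zero.1 (hr1 i)
  have hu : u ∈ MaynardDense.orthant k := logVec_mem_orthant hR1le r hr1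
  have hI : I ≤ I₂ := margInt_F_le_margInt_F₂ hk2 hu m
  have hI0 : 0 ≤ I := margInt_F_nonneg hk2 hu m
  have hI₂0 : 0 ≤ I₂ := margInt_F₂_nonneg hk2 hu m
  have hPg : T * Pg ≤ 2 * T * I₂ :=
    MaynardDense.T_mul_prod_le_two_mul_T_mul_setIntegral_F₂_update hCk hu m
  have hPg0 : 0 ≤ Pg :=
    Finset.prod_nonneg fun i _ => MaynardDense.prof_nonneg hk2 (MaynardDense.mem_orthant.1 hu i)
  have hF0ell : F0 * MaynardDense.ell k ≤ I₂ := MaynardDense.F₂_update_zero_mul_ell_le hk2 hu m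
  have hellT : Real.log k / 2 ≤ MaynardDense.ell k * T := MaynardDense.ell_mul_T_ge hCk
  have hell0 : 0 < MaynardDense.ell k := MaynardDense.ell_pos hk2
  have hF00 : 0 ≤ F0 := MaynardDense.F₂_nonneg hk2 (MaynardDense.update_mem_orthant hu m le_rfl)
  have hT0 : 0 < T := MaynardDense.T_pos hk2
  have hlogk : 0 < Real.log k := Real.log_pos (by exact_mod_cast (by omega : 1 < k))
  have hF0b : F0 ≤ 2 * T / Real.log k * I₂ := by
    have h1 : F0 ≤ I₂ / MaynardDense.ell k := by rw [le_div_iff₀ hell0]; exact hF0ell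
    have h2 : I₂ / MaynardDense.ell k ≤ 2 * T / Real.log k * I₂ := by
      rw [div_le_iff₀ hell0]
      have h3 : 1 ≤ 2 * T / Real.log k * MaynardDense.ell k := by
        rw [div_mul_eq_mul_div, le_div_iff₀ hlogk]; linarith
      calc I₂ = I₂ * 1 := (mul_one _).symm
        _ ≤ I₂ * (2 * T / Real.log k * MaynardDense.ell k) := mul_le_mul_of_nonneg_left h3 hI₂0
        _ = 2 * T / Real.log k * I₂ * MaynardDense.ell k := by ring
    exact h1.trans h2
  have hT1 : 1 ≤ T := by
    have hk3r : (3 : ℝ) ≤ k := by exact_mod_cast hk3'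
    have hlogk1 : 1 ≤ Real.log k := by
      rw [← Real.log_exp 1]; exact Real.log_le_log (Real.exp_pos 1) (le_trans he3 hk3r)
    have h := mul_le_mul hk3r hlogk1 zero_le_one hk0
    rw [hTdef]; unfold MaynardDense.T; linarith only [h]
  -- the constants of Lemmas 8.2 / 8.3
  have hU0 : 0 < U := MaynardDense.U_pos hk1
  have hA : 31 * (1 + 30 / U + T) ≤ 93 * T := MaynardDense.fiber_const_le hCk
  have hA0 : 0 ≤ 31 * (1 + 30 / U + T) := by positivity
  have hS : 30 + 30 / U + T ≤ 3 * T := MaynardDense.shift_const_le hCk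
  have hS' : 16 + 30 / U + T ≤ 3 * T := by linarith only [hS]
  have hS'0 : 0 ≤ 16 + 30 / U + T := by positivity
  -- sizes: `Λ = 10 k log x`
  set Λ : ℝ := 10 * k * Real.log x with hΛdef
  have hklx1 : 1 * 1 ≤ (k : ℝ) * Real.log x := mul_le_mul hkr1 hlx1 zero_le_one hk0
  have hΛ2 : 2 ≤ Λ := by rw [hΛdef]; linarith only [hklx1]
  have hΛ1 : 1 ≤ Λ := by linarith only [hΛ2]
  have hM0 : M ≠ 0 := emModulus_ne_zero hadm hB0 _ m hprod0
  have hlogM : Real.log (M : ℝ) ≤ Λ :=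
    log_emModulus_le hadm hnd hB0 hx1 hlx1 hlx3 hcoef hBx' hk hk1 hR1le hlogR3 hr
  have hΔ0 : Δ ≠ 0 := prod_crossDet_natAbs_ne_zero hnd m
  have hlogΔ : Real.log (Δ : ℝ) ≤ Λ :=
    (log_prod_crossDet_le hnd hx1 hlx3 hcoef m).trans (by rw [hΛdef]; linarith only [hklx1])
  have hSM : SM ≤ Real.log Λ + 3 := sum_primeFactors_log_div_le_of_log_le hM0 hΛ1 hlogM
  have hS₁ : S₁ ≤ Real.log Λ + 3 := sum_primeFactors_log_div_le_of_log_le hΔ0 hΛ1 hlogΔ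
  have hP₁ : P₁ ≤ Real.exp 5 * Real.log Λ := prod_primeFactors_one_add_inv_le_of_log_le hΔ0 hΛ2 hlogΔ
  have hSM0 : 0 ≤ SM := Finset.sum_nonneg fun p hp =>
    div_nonneg (Real.log_nonneg (by exact_mod_cast (Nat.prime_of_mem_primeFactors hp).one_lt.le))
      (Nat.cast_nonneg _)
  have hS₁0 : 0 ≤ S₁ := Finset.sum_nonneg fun p hp =>
    div_nonneg (Real.log_nonneg (by exact_mod_cast (Nat.prime_of_mem_primeFactors hp).one_lt.le))
      (Nat.cast_nonneg _)
  have hP₁0 : 0 ≤ P₁ := Finset.prod_nonneg fun p _ => by positivity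
  -- `log Λ ≤ 11 + 2ℓ`
  have hlogΛ : Real.log Λ ≤ 11 + 2 * ℓ := by
    have he27 : (2.7 : ℝ) ≤ Real.exp 1 := by have := Real.exp_one_gt_d9; linarith
    have hlog10 : Real.log 10 ≤ 3 := by
      rw [Real.log_le_iff_le_exp (by norm_num)]
      have h : Real.exp 3 = Real.exp 1 ^ 3 := by rw [← Real.exp_nat_mul]; norm_num
      rw [h]
      have := pow_le_pow_left₀ (by norm_num) he27 3
      linarith [show (10 : ℝ) ≤ (2.7 : ℝ) ^ 3 by norm_num]
    have hklx : (k : ℝ) ≤ Real.log x := hk.trans (Real.rpow_le_self_of_one_le hlx1 (by norm_num))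
    have hlogk' : Real.log k ≤ Real.log (Real.log x) := Real.log_le_log hkpos hklx
    rw [hΛdef, Real.log_mul (by positivity) hlx0.ne', Real.log_mul (by norm_num) hkpos.ne']
    linarith only [hlog10, hlogk', hllx]
  -- `Q ≤ 5ℓ`, `K_Δ ≤ K'_Δ ℓ²`
  have hQ : 9 + SM ≤ 5 * ℓ := by linarith only [hSM, hlogΛ, hll10]
  have hQ0 : 0 ≤ 9 + SM := by linarith only [hSM0]
  have hKΔ : 2 * Real.exp 6 * Real.exp (2 * Real.exp 6) * P₁ * (1 + S₁) ≤ KΔ' * ℓ ^ 2 := by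
    have h1 : P₁ ≤ Real.exp 5 * 4 * ℓ := by
      have : Real.log Λ ≤ 4 * ℓ := by linarith only [hlogΛ, hll10]
      calc P₁ ≤ Real.exp 5 * Real.log Λ := hP₁
        _ ≤ Real.exp 5 * (4 * ℓ) := mul_le_mul_of_nonneg_left this (Real.exp_pos 5).le
        _ = Real.exp 5 * 4 * ℓ := by ring
    have h2 : 1 + S₁ ≤ 4 * ℓ := by linarith only [hS₁, hlogΛ, hll10]
    calc 2 * Real.exp 6 * Real.exp (2 * Real.exp 6) * P₁ * (1 + S₁)
        ≤ 2 * Real.exp 6 * Real.exp (2 * Real.exp 6) * (Real.exp 5 * 4 * ℓ) * (4 * ℓ) :=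
          mul_le_mul (mul_le_mul_of_nonneg_left h1 (by positivity)) h2 (by linarith only [hS₁0])
            (by positivity)
      _ = KΔ' * ℓ ^ 2 := by rw [hKΔ'def]; ring
  have hKΔ0 : 0 ≤ 2 * Real.exp 6 * Real.exp (2 * Real.exp 6) * P₁ * (1 + S₁) := by positivity
  -- `T² ℓ ≤ 80 log k log R`
  have hk3'' : T ^ 2 * ℓ ≤ 80 * Real.log k * Real.log R := by
    have hlk : Real.log k ≤ k := by linarith only [Real.log_le_sub_one_of_pos hkpos]
    have hℓ0 : 0 ≤ ℓ := by linarith only [hll10]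
    rw [hTdef]; unfold MaynardDense.T
    calc ((k : ℝ) * Real.log k) ^ 2 * ℓ = ((k : ℝ) ^ 2 * ℓ * Real.log k) * Real.log k := by ring
      _ ≤ ((k : ℝ) ^ 2 * ℓ * Real.log k) * k := mul_le_mul_of_nonneg_left hlk (by positivity)
      _ = (k : ℝ) ^ 3 * ℓ * Real.log k := by ring
      _ ≤ 80 * Real.log R * Real.log k := mul_le_mul_of_nonneg_right hk3 hlogk.le
      _ = 80 * Real.log k * Real.log R := by ring
  -- `c_m ≥ 0`
  have hcM0 : 0 ≤ cM L B m := by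
    rw [cM_eq_yPref_mul hk1]
    exact mul_nonneg (yPref_pos hadm hnd hk1 hB0).le
      (div_nonneg (Nat.cast_nonneg _) (Nat.cast_nonneg _))
  -- assemble: the pointwise bound of `Maynard2016Lemma93Analytic` and the arithmetic
  exact (hpt k hCk L hadm hnd B hB0 R hR2' hRk hRk4 m r hr).trans
    (lemma93_arith hN hN0 hlR0 hI0 hI hI₂0 hC₁0 hC₂0 hQ0 hQ hA0 hA hPg0 hPg hS hS'0 hS' hKΔ0 hKΔ
      hKΔ'0 hF00 hF0b hlogk hT1 (by linarith only [hll10]) hk3'' hcM0 (Real.exp_pos 1).le)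

end FGKMT2018

/-- **Leaf M2 of Prop. 9.2 discharged** under the canonical `_holds` name of the named fact
`Maynard2016Lemma93Z` (the proof is `FGKMT2018.maynard2016Lemma93Z_holds`).
[cite: Maynard2016DenseClusters, Lemma 9.3 p. 22 (9.14), proof pp. 23–24 (9.23)–(9.30)] -/
theorem Maynard2016Lemma93Z_holds : Maynard2016Lemma93Z := FGKMT2018.maynard2016Lemma93Z_holds

end Literature.NumberTheory.Sieve

end
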